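import Summits.CriticalPhenomena.PercolationContinuityZ3.Theorems.PercExchangeRateTransportCriticalCurveRegular
import Literature.Probability.Percolation.UniformPercolation
import Literature.Probability.Percolation.CriticalContinuityProofs
import HarnessLib

/-!
# FWD-RUNG g17 over `CriticalCurveRegular_proof` — candidate cell `IsoLogDerivBlowup` (typed, critic-rejected)

Seed `g1-CriticalPhenomena-16065` (floor = `…Cruxes.CriticalCurveRegular.Locmod.CriticalCurveRegular_proof`,
item stmt-CriticalPhenomena-16065 of route PercExchangeRateTransport). The one cell not charted by gens 3–16:
the **fragile critical arm** at the isotropic corner `(p_c(p₃), p₃) = (p₃, p₃)` of the critical curve —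
the pivotal intensity of the one-arm event `{0 ⟷ ∂Λ_n}` at `p₃ = p_c(ℤ³)` outgrows every multiple of its
probability, `∀ M, M·θ_n(p₃) ≤ θ_n'(p₃)` eventually (`θ_n = DCT16.thetaN 3 n`, Russo derivative).

* `IsoLogDerivCore` — the isotropic core; `IsoLogDerivBlowup := floor ∧ core` — the candidate rung.
* `core_of_summit`, `rung_of_summit` — ON-PATH, UNCONDITIONAL: `S → core` (hence `S → rung`) from tree
  facts (`DCT16_lemma21_holds`, `tendsto_real_siteToBoundary`, `0 < p_c(ℤ³) ≤ 63/64`) and Remark 3 of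
  Duminil-Copin–Tassion 2016 at the endpoint, `φ_{p_c}(S) ≥ 1` for every finite `S ∋ 0`, PROVED here
  (`phiGeOneAtCritical_holds`, via continuity of `q ↦ φ_q(S)`, `continuous_phiR`; the tree's
  `perc_meanField_bound_holds` only used `q > p_c`).
* `rung_iff_core` — WHY IT IS REJECTED: the floor is a decorative conjunct; the curve `p_c(·)` enters only
  through the corner location, so the cell is not over this floor (gen-6 C3 precedent) and it is off-crux for
  K⁺/K⁻ (total pivotal intensity, not the exchange ratio `∂_tΘ_n/∂_pΘ_n`).

Sorry-free. Banked for a DCT16 / sharpness seed (`g1-CriticalPhenomena-lit-89bb7eba`).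
-/

noncomputable section

namespace Summit.CriticalPhenomena.PercolationContinuityZ3.Cruxes.SupercritExchangeUniformity.LogDerivBlowup

open Filter Topology
open Literature.Probability.Percolation Literature.Probability.Percolation.DCT16
open Literature.Probability.LatticeModels

/-- **Isotropic core (fragile critical arm at `p_c(ℤ³)`).** For every `M`, eventually in `n`,
`M · θ_n(p₃) ≤ θ_n'(p₃)` where `θ_n(q) = P_q[0 ⟷ ∂Λ_n]` on `ℤ³` (`DCT16.thetaN 3 n`, a polynomial in `q`)
and `θ_n'` is its derivative (`deriv`; by Russo's formula the expected number of pivotal edges, up to the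
factor of `DCT16_lemma21`). Under `θ(p₃) = 0` this is cheap (`core_of_summit`); in a jump world
(`θ(p₃) > 0`) it says the pivotal intensity at criticality diverges. [conjecture] -/
def IsoLogDerivCore : Prop :=
  ∀ M : ℝ, ∀ᶠ n : ℕ in atTop,
    M * DCT16.thetaN 3 n (criticalProb (zdGraph 3) 0) ≤
      deriv (DCT16.thetaN 3 n) (criticalProb (zdGraph 3) 0)

/-- **Candidate rung `IsoLogDerivBlowup` := floor ∧ isotropic core.** [conjecture] -/
def IsoLogDerivBlowup : Prop :=
  Theses.PercExchangeRateTransport.CriticalCurveRegular ∧ IsoLogDerivCore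

/-- The rung returns the floor (trivially: it is a conjunct). -/
theorem floor_of_rung (h : IsoLogDerivBlowup) :
    Theses.PercExchangeRateTransport.CriticalCurveRegular := h.1

/-- **Rejection certificate.** Given the landed floor, the rung is LITERALLY its isotropic core: the critical
curve contributes nothing beyond the corner location `p_c(p₃) = p₃`. Hence `instantiation = reject`
(the floor is not a specialisation of the rung at a parameter value; it is a dropped conjunct). -/
theorem rung_iff_core : IsoLogDerivBlowup ↔ IsoLogDerivCore :=
  ⟨And.right, fun h => ⟨CriticalCurveRegular.Locmod.CriticalCurveRegular_proof, h⟩⟩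

/-- **Duminil-Copin–Tassion 2016, Remark 3, at `d = 3`** (named input, not yet a tree theorem at the
endpoint): `φ_{p_c}(S) ≥ 1` for every finite `S ∋ 0`. (Printed proof: `φ_p(S)` is continuous in `p`, so
`φ_{p_c}(S) < 1` would put some `p > p_c` in the set defining `p̃_c = p_c`.)
[cite: DuminilCopinTassionEM2016, Remark 3] -/
def PhiGeOneAtCritical : Prop :=
  ∀ S : Finset (Site 3), (0 : Site 3) ∈ S →
    1 ≤ DCT16.phi (Set.projIcc 0 1 zero_le_one (criticalProb (zdGraph 3) 0)) S

/-- `q ↦ φ_q(S)` (real parameter, clamped to `[0,1]`) is continuous: each `P_q[0 ⟷ x in S]` is the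
cylinder polynomial of an event determined by the pairs inside `S` (`Russo.measureReal_eq_cylPoly`), as in
`continuous_thetaN`. [cite: DuminilCopinTassionEM2016, Remark 3] -/
theorem continuous_phiR (S : Finset (Site 3)) :
    Continuous fun q : ℝ => DCT16.phi (Set.projIcc 0 1 zero_le_one q) S := by
  classical
  have hterm : ∀ x : Site 3, Continuous fun q : ℝ =>
      (bondPercolation (zdGraph 3) (Set.projIcc 0 1 zero_le_one q)).real
        (openConnIn (↑S : Set (Site 3)) 0 x) := by
    intro x
    have hdet : DeterminedBy (openConnIn (↑S : Set (Site 3)) (0 : Site 3) x)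
        (↑(S.sym2) : Set (Sym2 (Site 3))) :=
      determinedBy_openConnIn (↑S) 0 x (K := ↑S.sym2) (by rw [Finset.coe_sym2])
    have h : (fun q : ℝ => (bondPercolation (zdGraph 3) (Set.projIcc 0 1 zero_le_one q)).real
        (openConnIn (↑S : Set (Site 3)) 0 x)) = fun q => Russo.cylPoly (zdGraph 3).edgeSet S.sym2
        (openConnIn (↑S : Set (Site 3)) 0 x) (Set.projIcc 0 1 zero_le_one q) := by
      funext q
      rw [bondPercolation]
      exact Russo.measureReal_eq_cylPoly hdet _ _
    rw [h]
    have hc : Continuous (Russo.cylPoly (zdGraph 3).edgeSet S.sym2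
        (openConnIn (↑S : Set (Site 3)) 0 x)) :=
      continuous_iff_continuousAt.2 fun q => (Russo.hasDerivAt_cylPoly _ _ _ q).continuousAt
    exact hc.comp (continuous_subtype_val.comp continuous_projIcc)
  simp only [DCT16.phi_def]
  refine (continuous_subtype_val.comp continuous_projIcc).mul ?_
  exact continuous_finsetSum _ fun x _ => continuous_finsetSum _ fun y _ => hterm x

/-- **Remark 3 of Duminil-Copin–Tassion 2016 at `d = 3`, PROVED from tree facts**: if `φ_{p_c}(S) < 1`,
continuity (`continuous_phiR`) gives `φ_q(S) < 1` for some `q ∈ (p_c, 1)`, so `q ≤ p̃_c = p_c`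
(`DCT16_tildeCriticalProb_eq_criticalProb_holds`), absurd. [cite: DuminilCopinTassionEM2016, Remark 3] -/
theorem phiGeOneAtCritical_holds : PhiGeOneAtCritical := by
  intro S h0S
  set pc : ℝ := criticalProb (zdGraph 3) 0 with hpc
  have hpc0 : 0 < pc := criticalProb_zd_pos 3 (by norm_num)
  have hpc1 : pc < 1 := lt_of_le_of_lt (criticalProb_zd_le (d := 3) (by norm_num)) (by norm_num)
  by_contra hlt
  push Not at hlt
  have hopen : IsOpen {q : ℝ | DCT16.phi (Set.projIcc 0 1 zero_le_one q) S < 1} :=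
    isOpen_lt (continuous_phiR S) continuous_const
  obtain ⟨ε, hε, hball⟩ := Metric.isOpen_iff.1 hopen pc hlt
  set m : ℝ := min (ε / 2) ((1 - pc) / 2) with hm
  have hm0 : 0 < m := lt_min (half_pos hε) (half_pos (by linarith))
  have hmε : m ≤ ε / 2 := min_le_left _ _
  have hm1 : m ≤ (1 - pc) / 2 := min_le_right _ _
  set q : ℝ := pc + m with hq
  have hq0 : 0 ≤ q := by linarith
  have hq1 : q < 1 := by linarith
  have hqball : q ∈ Metric.ball pc ε := by
    rw [Metric.mem_ball, Real.dist_eq, abs_of_pos (by linarith)]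
    linarith
  have hφq : DCT16.phi (Set.projIcc 0 1 zero_le_one q) S < 1 := hball hqball
  rw [Set.projIcc_of_mem zero_le_one ⟨hq0, hq1.le⟩] at hφq
  have hle : q ≤ DCT16.tildeCriticalProb 3 :=
    le_csSup (DCT16.bddAbove_tildeSet 3) ⟨⟨hq0, hq1.le⟩, S, h0S, hφq⟩
  rw [DCT16_tildeCriticalProb_eq_criticalProb_holds (d := 3) (by norm_num)] at hle
  linarith

/-- **ON-PATH (`S → core`), UNCONDITIONAL.** From `θ(p₃) = 0`: `θ_n(p₃) ↓ 0`
(`tendsto_real_siteToBoundary`), while Lemma 2.1 of Duminil-Copin–Tassion (`DCT16_lemma21_holds`) with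
`inf_S φ_{p₃}(S) ≥ 1` (`phiGeOneAtCritical_holds`) gives `θ_n'(p₃) ≥ (1 - θ_n(p₃))/(p₃(1-p₃)) ≥ K/2 > 0`
eventually; so `M θ_n(p₃) ≤ K/2 ≤ θ_n'(p₃)` eventually. -/
theorem core_of_summit (hS : _root_.PercolationContinuityZ3) : IsoLogDerivCore := by
  have hφ : PhiGeOneAtCritical := phiGeOneAtCritical_holds
  set pc : ℝ := criticalProb (zdGraph 3) 0 with hpc
  have hpc0 : 0 < pc := criticalProb_zd_pos 3 (by norm_num)
  have hpc1 : pc < 1 := lt_of_le_of_lt (criticalProb_zd_le (d := 3) (by norm_num)) (by norm_num)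
  have hproj : Set.projIcc (0 : ℝ) 1 zero_le_one pc = criticalProbI 3 := by
    rw [Set.projIcc_of_mem zero_le_one (show pc ∈ Set.Icc (0 : ℝ) 1 from ⟨hpc0.le, hpc1.le⟩)]
    rfl
  -- `θ_n(p_c) → θ(p_c) = 0`
  have hlim : Tendsto (fun n : ℕ => DCT16.thetaN 3 n pc) atTop (𝓝 0) := by
    have h := tendsto_real_siteToBoundary (d := 3) (criticalProbI 3)
    have hS' : theta (zdGraph 3) 0 (criticalProbI 3) = 0 := hS
    rw [hS'] at h
    refine h.congr' (Eventually.of_forall fun n => ?_)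
    show (bondPercolation (zdGraph 3) (criticalProbI 3)).real (siteToBoundary 3 n) = DCT16.thetaN 3 n pc
    rw [DCT16.thetaN, hproj]
  intro M
  have hK : 0 < 1 / (pc * (1 - pc)) := one_div_pos.2 (mul_pos hpc0 (by linarith))
  set K : ℝ := 1 / (pc * (1 - pc)) with hKdef
  have hev1 : ∀ᶠ n : ℕ in atTop, DCT16.thetaN 3 n pc ≤ 1 / 2 :=
    hlim.eventually (eventually_le_nhds (by norm_num))
  have hev2 : ∀ᶠ n : ℕ in atTop, M * DCT16.thetaN 3 n pc ≤ K / 2 := by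
    have h2 : Tendsto (fun n : ℕ => M * DCT16.thetaN 3 n pc) atTop (𝓝 (M * 0)) := hlim.const_mul M
    rw [mul_zero] at h2
    exact h2.eventually (eventually_le_nhds (half_pos hK))
  filter_upwards [hev1, hev2, eventually_ge_atTop 1] with n hn1 hn2 hn
  obtain ⟨D, hD, hle⟩ := DCT16_lemma21_holds (d := 3) n hn pc ⟨hpc0, hpc1⟩
  rw [hD.deriv]
  have hinf : 1 ≤ (DCT16.originSets 3 n).inf' (DCT16.originSets_nonempty 3 n)
      (fun S => DCT16.phi (Set.projIcc 0 1 zero_le_one pc) S) :=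
    Finset.le_inf' _ _ fun S hS => hφ S (DCT16.mem_originSets.1 hS).2
  set I : ℝ := (DCT16.originSets 3 n).inf' (DCT16.originSets_nonempty 3 n)
      (fun S => DCT16.phi (Set.projIcc 0 1 zero_le_one pc) S) with hIdef
  have hle' : K * I * (1 - DCT16.thetaN 3 n pc) ≤ D := hle
  have hθ : 1 / 2 ≤ 1 - DCT16.thetaN 3 n pc := by linarith
  have hA : (1 : ℝ) * (1 / 2) ≤ I * (1 - DCT16.thetaN 3 n pc) :=
    mul_le_mul hinf hθ (by norm_num) (zero_le_one.trans hinf)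
  have hB : K * ((1 : ℝ) * (1 / 2)) ≤ K * (I * (1 - DCT16.thetaN 3 n pc)) :=
    mul_le_mul_of_nonneg_left hA hK.le
  have h1 : K / 2 ≤ K * I * (1 - DCT16.thetaN 3 n pc) := by
    calc K / 2 = K * ((1 : ℝ) * (1 / 2)) := by ring
      _ ≤ K * (I * (1 - DCT16.thetaN 3 n pc)) := hB
      _ = K * I * (1 - DCT16.thetaN 3 n pc) := by ring
  linarith

/-- **ON-PATH for the rung** (`S → IsoLogDerivBlowup`), unconditional, with the landed floor. -/
theorem rung_of_summit (hS : _root_.PercolationContinuityZ3) : IsoLogDerivBlowup :=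
  ⟨CriticalCurveRegular.Locmod.CriticalCurveRegular_proof, core_of_summit hS⟩

attribute [aesop safe apply] rung_of_summit core_of_summit

end Summit.CriticalPhenomena.PercolationContinuityZ3.Cruxes.SupercritExchangeUniformity.LogDerivBlowup

end
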